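import Literature.Topology.FourManifolds.PalaisBallComplement
import Literature.Topology.FourManifolds.ClosedBallProofs
import Literature.Topology.FourManifolds.CerfGammaFourProofs

/-!
# Helper `helper_fakeBall_disc_of_diffeomorph_sphere` of line `stable-seam-host` for crux
`OrigamiFoldExistence` (item stmt-SmoothPoincare4-7844; brick B)

The line cuts a homotopy `4`-sphere `S` along a chart ball `e : ℝ⁴ ↪ S` and works with the
**fake ball** `S ∖ e(B̊⁴)`.  If `S` is diffeomorphic to the round `S⁴ ⊂ ℝ⁵`, the fake ball is a
genuine disc, parametrised compatibly with `e`: there is a smooth embedding `G : ℝ⁴ → S` of the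
whole model space with `G = e` on the unit sphere and `G(𝔻⁴) = S ∖ e(B̊⁴)`.

Proof: transport the tree's Palais ball-complement theorem
(`Literature.Topology.FourManifolds.hasComplementBall_of_isSmoothEmbedding`,
`PalaisBallComplement.lean`; Palais 1960, Thm. B; Hirsch 1976, Ch. 8 Thm. 3.1) along the
diffeomorphism `Φ : S ≅ S⁴`: `Φ ∘ e : ℝ⁴ → S⁴` is a smooth embedding, so there are an open
`U ⊆ S⁴` and a diffeomorphism `c : ℝ⁴ ≅ U` with `c = Φ ∘ e` on the unit sphere and
`c(𝔻⁴) = S⁴ ∖ Φ(e(B̊⁴))`; then `G := Φ⁻¹ ∘ c` does it (`Φ⁻¹` is a bijection, so it maps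
complements to complements).

## References

* R. Palais, *Extending diffeomorphisms*, Proc. AMS 11 (1960) 274–277, Thm. B.
* M. W. Hirsch, *Differential Topology*, GTM 33, Springer (1976), Ch. 8, Thm. 3.1.
-/

noncomputable section

-- the prescribed namespace `Summit.<P>.<Sub>.…` duplicates `SmoothPoincare4` (P = Sub)
set_option linter.dupNamespace false

open scoped Manifold ContDiff Topology
open Set Function Metric
open Literature.Topology.FourManifolds

namespace Summit.SmoothPoincare4.SmoothPoincare4.Theorems.OrigamiFoldExistence.StableSeamHost

/-- **The fake ball of a chart ball in a manifold diffeomorphic to `S⁴` is a disc with the same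
boundary values.**  For a smooth embedding `e : ℝ⁴ → S` of the whole model space into a
`4`-manifold `S` diffeomorphic to the round sphere `S⁴ ⊂ ℝ⁵` there is a smooth embedding
`G : ℝ⁴ → S` with `G = e` on the unit sphere `‖y‖ = 1` and `G(𝔻⁴) = S ∖ e(B̊⁴)` (Palais' disc
theorem in ball-complement form, transported along the diffeomorphism).
[cite: HirschDT1976, Ch. 8 Thm. 3.1] [cite: Palais1960, Thm. B] -/
theorem helper_fakeBall_disc_of_diffeomorph_sphere : ∀ (S : Type) [TopologicalSpace S] [T2Space S] [SecondCountableTopology S] [ChartedSpace (EuclideanSpace ℝ (Fin 4)) S] [IsManifold (𝓡 4) ∞ S] (e : EuclideanSpace ℝ (Fin 4) → S), Nonempty (S ≃ₘ⟮𝓡 4, 𝓡 4⟯ Metric.sphere (0 : EuclideanSpace ℝ (Fin 5)) 1) → Manifold.IsSmoothEmbedding (𝓡 4) (𝓡 4) ∞ e → ∃ G : EuclideanSpace ℝ (Fin 4) → S, Manifold.IsSmoothEmbedding (𝓡 4) (𝓡 4) ∞ G ∧ (∀ y : EuclideanSpace ℝ (Fin 4), ‖y‖ = 1 → G y = e y)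 ∧ G '' Metric.closedBall (0 : EuclideanSpace ℝ (Fin 4)) 1 = (e '' Metric.ball (0 : EuclideanSpace ℝ (Fin 4)) 1)ᶜ := by
  intro S _ _ _ _ _ e hΦ he
  obtain ⟨Φ⟩ := hΦ
  haveI : Fact (Module.finrank ℝ (EuclideanSpace ℝ (Fin 5)) = 4 + 1) := ⟨finrank_euclideanSpace_fin⟩
  -- `Φ ∘ e : ℝ⁴ → S⁴` is a smooth embedding; Palais gives its complementary ball `c : ℝ⁴ ≅ U`
  have he₁ : Manifold.IsSmoothEmbedding (𝓡 4) (𝓡 4) ∞ (Φ ∘ e) := he.diffeomorph_comp Φ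
  obtain ⟨U, c, h1, h2⟩ := hasComplementBall_of_isSmoothEmbedding (n := 4) he₁
  refine ⟨Φ.symm ∘ (Subtype.val ∘ c), ?_, fun y hy ↦ ?_, ?_⟩
  · -- `Φ⁻¹ ∘ (U ↪ S⁴) ∘ c` is a smooth embedding
    exact ((Manifold.IsSmoothEmbedding.of_opens U).comp_diffeomorph c).diffeomorph_comp Φ.symm
  · -- boundary values: `Φ⁻¹ (c y) = Φ⁻¹ (Φ (e y)) = e y`
    simp only [comp_apply, h1 y hy]
    exact Φ.symm_apply_apply (e y)
  · -- image: `Φ⁻¹ (c(𝔻⁴)) = Φ⁻¹ (S⁴ ∖ Φ(e(B̊⁴))) = S ∖ e(B̊⁴)`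
    have hbij : Bijective (Φ.symm : Metric.sphere (0 : EuclideanSpace ℝ (Fin 5)) 1 → S) :=
      Φ.symm.bijective
    rw [image_comp, h2, image_compl_eq hbij, ← image_comp]
    congr 1
    refine image_congr fun y _ ↦ ?_
    simp

end Summit.SmoothPoincare4.SmoothPoincare4.Theorems.OrigamiFoldExistence.StableSeamHost

end
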